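import Summits.CriticalPhenomena.PercolationContinuityZ3.Theorems.PercNearOneGluingNoHeavyLowerTailIncStarRootEdgeTwoBond
import Summits.CriticalPhenomena.PercolationContinuityZ3.Theorems.PercNearOneGluingNoHeavyLowerTailIncStarStrongInduction
import HarnessLib

/-!
# The joint (star, hRZ) induction assembled: the increasing star on every finite weighted graph from the four mixed two-edge fibres

Support file for the Sahi programme (`--supports stmt-CriticalPhenomena-4575`, prover prim-sahi-p2 gen 30).  No definitions, no named facts, no
sorries; standard axioms.  Memo `run/shared/lean/prim/prim-sahi/FROM-prim-sahi-p2-gen29-ROOT-FIBRE-DICHOTOMY.md` §4c–§5 (the assembly asked for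
there), `prim-sahi-p2/PROOF-E3.md` §39–§40.

Gen 5 reduced the increasing star `E₃({s↔b},{s↔c},{s↔y}) ≥ 0` to hRZ — nonnegativity of the two mixed Bernstein coefficients
`polar₁(P_{w[e↦0]}, P_{w[e↦1]})`, `polar₁(P_{w[e↦1]}, P_{w[e↦0]})` along a fractional root pair `e = s(s,z)`
(`IncStar.incStar_nonneg_of_rootEdgeBernsteinStrongIH`).  Gen 29 showed that hRZ is itself inductive: along a second pair `e₁ ≠ e` the two forms
are Bernstein cubics in `w e₁` whose corner coefficients are the hRZ forms of `w[e₁↦0]`, `w[e₁↦1]` and whose middle coefficients are the four mixed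
two-edge fibres `twoEdgeRF11/12/21/22 w e₁ e` (`EdgeInduction.rootEdgeBernstein_of_twoEdgeFibres`).  This file runs that induction to the end:

* `rootEdgeBernstein_of_detOffPair` — the base: if every non-loop pair other than `e` has weight `0` or `1`, both laws `P_{w[e↦0]}`, `P_{w[e↦1]}`
  are almost surely deterministic on the hub connections, and the two forms are the explicit polynomials `(2X + 4Y − 2Σ_t x_t y_j y_k)/6`,
  `(4X + 2Y − 2Σ_t y_t x_j x_k)/6` in the reachability indicators `x ≤ y` of the two sure graphs, nonnegative by a finite check;
* `rootEdgeBernstein_of_twoEdgeFibres_all` — **hRZ on every finite weighted graph, along every root pair, from the hypothesis 𝒯₂**: for every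
  weight, root `s`, `z ≠ s`, targets and every fractional non-loop pair `e₁ ≠ s(s,z)`, the four mixed two-edge fibres of `(e₁, s(s,z))` are `≥ 0`
  (induction on the number of fractional non-loop pairs other than `s(s,z)`);
* `incStar_nonneg_of_twoEdgeFibres` — **the increasing star on every finite weighted graph from 𝒯₂** (gen 5's schema fed with the previous theorem).

Nothing here asserts 𝒯₂.  Status of 𝒯₂ (memo §4c, PROOF-E3 §39–§40): it is implied by three-copy fibre positivity (certified on every graph with
≤ 8 vertices and on Petersen/LAD/M₈-type supports, 0 violations anywhere); at a root of degree two the four fibres are CERTIFIED (RF11 by Harris —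
tree `IncStar.twoEdgeRF11_nonneg_of_degTwoRoot` —, RF12/RF21 by exact Harris + van den Berg–Kahn + star certificates, RF22 by an exact certificate
using in addition the two hRZ rows of `G − s`); gen 30 reorganises the general case as a vertex induction in which only the '3-free' root fibres need
certificates (PROOF-E3 §40).
-/

noncomputable section

namespace Summit.CriticalPhenomena.PercolationContinuityZ3.Theorems

namespace IncStar

open MeasureTheory Set Literature.Probability.Percolation Literature.Probability.LatticeModels EdgeInduction
open scoped Classical

variable {n : ℕ}

/-! ### Deterministic hub: probabilities of the hub connections are indicators -/

/-- If every non-loop pair has weight `0` or `1`, every pair leaving the weight-`1` component of `s` has weight `0`. [folklore] -/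
theorem hub_closed_of_zeroOne (w : Sym2 (Fin n) → unitInterval) (s : Fin n)
    (hdet : ∀ f : Sym2 (Fin n), ¬ f.IsDiag → (w f = 0 ∨ w f = 1)) :
    ∀ z v : Fin n, (SimpleGraph.fromEdgeSet {e : Sym2 (Fin n) | w e = 1}).Reachable s z →
      ¬ (SimpleGraph.fromEdgeSet {e : Sym2 (Fin n) | w e = 1}).Reachable s v → z ≠ v → w s(z, v) = 0 := by
  intro z v hz hv hzv
  rcases hdet s(z, v) (by rw [Sym2.mk_isDiag_iff]; exact hzv) with h0 | h1
  · exact h0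
  · exact absurd (hz.trans (SimpleGraph.Adj.reachable (by
      rw [SimpleGraph.fromEdgeSet_adj]; exact ⟨h1, hzv⟩))) hv

/-- If `P(G) = 1` then `P({ω | P} ∩ G) = [P]` for a constant proposition `P`. [folklore] -/
theorem real_setOf_inter_eq_ite {μ : Measure (BondConfig (Fin n))} {G : Set (BondConfig (Fin n))} (hG : μ.real G = 1)
    (P : Prop) {d : Decidable P} : μ.real ({_ω : BondConfig (Fin n) | P} ∩ G) = @ite ℝ P d 1 0 := by
  by_cases hP : P
  · rw [if_pos hP]
    have hS : ({_ω : BondConfig (Fin n) | P} : Set (BondConfig (Fin n))) = Set.univ := by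
      ext ω; simp only [Set.mem_setOf_eq, Set.mem_univ, iff_true]; exact hP
    rw [hS, Set.univ_inter]; exact hG
  · rw [if_neg hP]
    have hS : ({_ω : BondConfig (Fin n) | P} : Set (BondConfig (Fin n))) = ∅ := by
      ext ω; simp only [Set.mem_setOf_eq, Set.mem_empty_iff_false, iff_false]; exact hP
    rw [hS, Set.empty_inter]; simp

/-- Deterministic hub, one connection: `P(s ↔ i) = [i in the weight-1 component of s]`. [this work] -/
theorem hub_real_one (w : Sym2 (Fin n) → unitInterval) (s : Fin n)
    (hdet : ∀ f : Sym2 (Fin n), ¬ f.IsDiag → (w f = 0 ∨ w f = 1)) (i : Fin n) :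
    (prodBernoulli w).real (openConn s i) =
      if (SimpleGraph.fromEdgeSet {e : Sym2 (Fin n) | w e = 1}).Reachable s i then 1 else 0 := by
  have hcl := hub_closed_of_zeroOne w s hdet
  set G : Set (BondConfig (Fin n)) := {ω | ∀ e, w e = 1 → e ∈ ω} ∩ {ω | ∀ e, w e = 0 → e ∉ ω} with hGdef
  have hG : (prodBernoulli w).real G = 1 := real_sureSet w
  have hm : MeasurableSet G := MeasurableSet.of_discrete
  rw [real_eq_real_inter_of_real_eq_one hm hG]
  have hconst : openConn s i ∩ G = {ω | (SimpleGraph.fromEdgeSet {e : Sym2 (Fin n) | w e = 1}).Reachable s i} ∩ G := by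
    ext ω
    simp only [Set.mem_inter_iff, Set.mem_setOf_eq, hGdef]
    constructor
    · rintro ⟨h, h1, h0⟩; exact ⟨(openConn_iff_sureReachable_of_closed w s hcl h1 h0 i).1 h, h1, h0⟩
    · rintro ⟨h, h1, h0⟩; exact ⟨(openConn_iff_sureReachable_of_closed w s hcl h1 h0 i).2 h, h1, h0⟩
  rw [hconst]
  exact real_setOf_inter_eq_ite hG _

/-- Deterministic hub, two connections. [this work] -/
theorem hub_real_two (w : Sym2 (Fin n) → unitInterval) (s : Fin n)
    (hdet : ∀ f : Sym2 (Fin n), ¬ f.IsDiag → (w f = 0 ∨ w f = 1)) (i j : Fin n) :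
    (prodBernoulli w).real (openConn s i ∩ openConn s j) =
      if ((SimpleGraph.fromEdgeSet {e : Sym2 (Fin n) | w e = 1}).Reachable s i ∧
          (SimpleGraph.fromEdgeSet {e : Sym2 (Fin n) | w e = 1}).Reachable s j) then 1 else 0 := by
  have hcl := hub_closed_of_zeroOne w s hdet
  set G : Set (BondConfig (Fin n)) := {ω | ∀ e, w e = 1 → e ∈ ω} ∩ {ω | ∀ e, w e = 0 → e ∉ ω} with hGdef
  have hG : (prodBernoulli w).real G = 1 := real_sureSet w
  have hm : MeasurableSet G := MeasurableSet.of_discrete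
  rw [real_eq_real_inter_of_real_eq_one hm hG]
  have hconst : openConn s i ∩ openConn s j ∩ G = {ω | (SimpleGraph.fromEdgeSet {e : Sym2 (Fin n) | w e = 1}).Reachable s i ∧ (SimpleGraph.fromEdgeSet {e : Sym2 (Fin n) | w e = 1}).Reachable s j} ∩ G := by
    ext ω
    simp only [Set.mem_inter_iff, Set.mem_setOf_eq, hGdef]
    constructor
    · rintro ⟨⟨hi, hj⟩, h1, h0⟩
      exact ⟨⟨(openConn_iff_sureReachable_of_closed w s hcl h1 h0 i).1 hi,
        (openConn_iff_sureReachable_of_closed w s hcl h1 h0 j).1 hj⟩, h1, h0⟩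
    · rintro ⟨⟨hi, hj⟩, h1, h0⟩
      exact ⟨⟨(openConn_iff_sureReachable_of_closed w s hcl h1 h0 i).2 hi,
        (openConn_iff_sureReachable_of_closed w s hcl h1 h0 j).2 hj⟩, h1, h0⟩
  rw [hconst]
  exact real_setOf_inter_eq_ite hG _

/-- Deterministic hub, three connections. [this work] -/
theorem hub_real_three (w : Sym2 (Fin n) → unitInterval) (s : Fin n)
    (hdet : ∀ f : Sym2 (Fin n), ¬ f.IsDiag → (w f = 0 ∨ w f = 1)) (i j k : Fin n) :
    (prodBernoulli w).real (openConn s i ∩ openConn s j ∩ openConn s k) =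
      if ((SimpleGraph.fromEdgeSet {e : Sym2 (Fin n) | w e = 1}).Reachable s i ∧
          (SimpleGraph.fromEdgeSet {e : Sym2 (Fin n) | w e = 1}).Reachable s j ∧
          (SimpleGraph.fromEdgeSet {e : Sym2 (Fin n) | w e = 1}).Reachable s k) then 1 else 0 := by
  have hcl := hub_closed_of_zeroOne w s hdet
  set G : Set (BondConfig (Fin n)) := {ω | ∀ e, w e = 1 → e ∈ ω} ∩ {ω | ∀ e, w e = 0 → e ∉ ω} with hGdef
  have hG : (prodBernoulli w).real G = 1 := real_sureSet w
  have hm : MeasurableSet G := MeasurableSet.of_discrete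
  rw [real_eq_real_inter_of_real_eq_one hm hG]
  have hconst : openConn s i ∩ openConn s j ∩ openConn s k ∩ G =
      {ω | (SimpleGraph.fromEdgeSet {e : Sym2 (Fin n) | w e = 1}).Reachable s i ∧ (SimpleGraph.fromEdgeSet {e : Sym2 (Fin n) | w e = 1}).Reachable s j ∧ (SimpleGraph.fromEdgeSet {e : Sym2 (Fin n) | w e = 1}).Reachable s k} ∩ G := by
    ext ω
    simp only [Set.mem_inter_iff, Set.mem_setOf_eq, hGdef]
    constructor
    · rintro ⟨⟨⟨hi, hj⟩, hk⟩, h1, h0⟩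
      exact ⟨⟨(openConn_iff_sureReachable_of_closed w s hcl h1 h0 i).1 hi,
        (openConn_iff_sureReachable_of_closed w s hcl h1 h0 j).1 hj,
        (openConn_iff_sureReachable_of_closed w s hcl h1 h0 k).1 hk⟩, h1, h0⟩
    · rintro ⟨⟨hi, hj, hk⟩, h1, h0⟩
      exact ⟨⟨⟨(openConn_iff_sureReachable_of_closed w s hcl h1 h0 i).2 hi,
        (openConn_iff_sureReachable_of_closed w s hcl h1 h0 j).2 hj⟩,
        (openConn_iff_sureReachable_of_closed w s hcl h1 h0 k).2 hk⟩, h1, h0⟩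
  rw [hconst]
  exact real_setOf_inter_eq_ite hG _

/-! ### The base of the hRZ induction: every other non-loop pair deterministic -/

/-- **Base of the hRZ induction.**  If every non-loop pair other than `e = s(s,z)` has weight `0` or `1`, both root-edge Bernstein forms of the
increasing star along `e` are nonnegative: the two laws are deterministic on the hub connections, the reachability pattern under `w[e↦0]` is below
the one under `w[e↦1]`, and the two forms are the polynomials `(2X + 4Y − 2Σ_t x_t y_j y_k)/6`, `(4X + 2Y − 2Σ_t y_t x_j x_k)/6`
in the two patterns `x ≤ y`, checked case by case. [this work] -/
theorem rootEdgeBernstein_of_detOffPair (w : Sym2 (Fin n) → unitInterval) (s z b c y : Fin n)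
    (hdet : ∀ f : Sym2 (Fin n), ¬ f.IsDiag → f ≠ s(s, z) → (w f = 0 ∨ w f = 1)) :
    0 ≤ polar₁ (prodBernoulli (Function.update w s(s, z) 0)) (prodBernoulli (Function.update w s(s, z) 1))
        (openConn s b) (openConn s c) (openConn s y) ∧
      0 ≤ polar₁ (prodBernoulli (Function.update w s(s, z) 1)) (prodBernoulli (Function.update w s(s, z) 0))
        (openConn s b) (openConn s c) (openConn s y) := by
  set w0 := Function.update w s(s, z) (0 : unitInterval) with hw0
  set w1 := Function.update w s(s, z) (1 : unitInterval) with hw1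
  have hdet0 : ∀ f : Sym2 (Fin n), ¬ f.IsDiag → (w0 f = 0 ∨ w0 f = 1) := by
    intro f hf
    by_cases hfe : f = s(s, z)
    · left; rw [hfe, hw0, Function.update_self]
    · rw [hw0, Function.update_of_ne hfe]; exact hdet f hf hfe
  have hdet1 : ∀ f : Sym2 (Fin n), ¬ f.IsDiag → (w1 f = 0 ∨ w1 f = 1) := by
    intro f hf
    by_cases hfe : f = s(s, z)
    · right; rw [hfe, hw1, Function.update_self]
    · rw [hw1, Function.update_of_ne hfe]; exact hdet f hf hfe
  -- the sure graph of `w[e↦0]` is a subgraph of the sure graph of `w[e↦1]`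
  have hle : SimpleGraph.fromEdgeSet {e : Sym2 (Fin n) | w0 e = 1} ≤ SimpleGraph.fromEdgeSet {e : Sym2 (Fin n) | w1 e = 1} := by
    refine SimpleGraph.fromEdgeSet_mono ?_
    intro f hf
    have h1 : w0 f = 1 := hf
    show w1 f = 1
    by_cases hfe : f = s(s, z)
    · rw [hfe, hw1, Function.update_self]
    · rw [hw0, Function.update_of_ne hfe] at h1
      rw [hw1, Function.update_of_ne hfe]; exact h1
  have hb' : (SimpleGraph.fromEdgeSet {e : Sym2 (Fin n) | w0 e = 1}).Reachable s b →
      (SimpleGraph.fromEdgeSet {e : Sym2 (Fin n) | w1 e = 1}).Reachable s b := fun h => h.mono hle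
  have hc' : (SimpleGraph.fromEdgeSet {e : Sym2 (Fin n) | w0 e = 1}).Reachable s c →
      (SimpleGraph.fromEdgeSet {e : Sym2 (Fin n) | w1 e = 1}).Reachable s c := fun h => h.mono hle
  have hy' : (SimpleGraph.fromEdgeSet {e : Sym2 (Fin n) | w0 e = 1}).Reachable s y →
      (SimpleGraph.fromEdgeSet {e : Sym2 (Fin n) | w1 e = 1}).Reachable s y := fun h => h.mono hle
  simp only [polar₁, hub_real_one w0 s hdet0, hub_real_two w0 s hdet0, hub_real_three w0 s hdet0,
    hub_real_one w1 s hdet1, hub_real_two w1 s hdet1, hub_real_three w1 s hdet1]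
  by_cases h1 : (SimpleGraph.fromEdgeSet {e : Sym2 (Fin n) | w0 e = 1}).Reachable s b <;>
    by_cases h2 : (SimpleGraph.fromEdgeSet {e : Sym2 (Fin n) | w0 e = 1}).Reachable s c <;>
      by_cases h3 : (SimpleGraph.fromEdgeSet {e : Sym2 (Fin n) | w0 e = 1}).Reachable s y <;>
        by_cases h4 : (SimpleGraph.fromEdgeSet {e : Sym2 (Fin n) | w1 e = 1}).Reachable s b <;>
          by_cases h5 : (SimpleGraph.fromEdgeSet {e : Sym2 (Fin n) | w1 e = 1}).Reachable s c <;>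
            by_cases h6 : (SimpleGraph.fromEdgeSet {e : Sym2 (Fin n) | w1 e = 1}).Reachable s y <;>
              simp [h1, h2, h3, h4, h5, h6] at hb' hc' hy' ⊢ <;> norm_num

/-! ### The induction -/

/-- Setting the weight of a fractional non-loop pair `e₁ ≠ e` to `0` or `1` strictly decreases the number of fractional non-loop pairs other than `e`.
[folklore] -/
theorem card_fracOff_update_lt (w : Sym2 (Fin n) → unitInterval) {e e₁ : Sym2 (Fin n)} (he₁ : e₁ ∈ fracEdges w)
    (hnd : ¬ e₁.IsDiag) (hne : e₁ ≠ e) (u : unitInterval) (hu : u = 0 ∨ u = 1) :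
    ((fracEdges (Function.update w e₁ u)).filter fun f => ¬ f.IsDiag ∧ f ≠ e).card <
      ((fracEdges w).filter fun f => ¬ f.IsDiag ∧ f ≠ e).card := by
  have hmemf : e₁ ∈ (fracEdges w).filter fun f => ¬ f.IsDiag ∧ f ≠ e := Finset.mem_filter.2 ⟨he₁, hnd, hne⟩
  have hsub : ((fracEdges (Function.update w e₁ u)).filter fun f => ¬ f.IsDiag ∧ f ≠ e) ⊆
      ((fracEdges w).filter fun f => ¬ f.IsDiag ∧ f ≠ e).erase e₁ := by
    intro f hf
    rw [Finset.mem_filter] at hf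
    have hf' := fracEdges_update_subset w e₁ u hu hf.1
    rw [Finset.mem_erase] at hf' ⊢
    exact ⟨hf'.1, Finset.mem_filter.2 ⟨hf'.2, hf.2⟩⟩
  have h1 := Finset.card_le_card hsub
  rw [Finset.card_erase_of_mem hmemf] at h1
  have hpos := Finset.card_pos.2 ⟨_, hmemf⟩
  omega

/-- **hRZ ON EVERY FINITE WEIGHTED GRAPH FROM THE FOUR MIXED TWO-EDGE FIBRES (𝒯₂).**  Suppose that for every weight `w`, every root `s`, every
`z ≠ s`, all targets `b c y` and every fractional non-loop pair `e₁ ≠ s(s,z)` the four mixed two-edge fibres `twoEdgeRF11/12/21/22 w e₁ s(s,z)` of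
the increasing star are nonnegative.  Then for every weight, root, `z ≠ s` and targets, both root-edge Bernstein (hRZ) forms of the increasing star
along `s(s,z)` are nonnegative.  Induction on the number of fractional non-loop pairs other than `s(s,z)`: the step is
`EdgeInduction.rootEdgeBernstein_of_twoEdgeFibres`, the base is `rootEdgeBernstein_of_detOffPair`. [this work] -/
theorem rootEdgeBernstein_of_twoEdgeFibres_all
    (hT : ∀ (w : Sym2 (Fin n) → unitInterval) (s z b c y : Fin n) (e₁ : Sym2 (Fin n)),
      z ≠ s → e₁ ≠ s(s, z) → ¬ e₁.IsDiag → e₁ ∈ fracEdges w →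
      0 ≤ twoEdgeRF11 w e₁ s(s, z) (openConn s b) (openConn s c) (openConn s y) ∧
        0 ≤ twoEdgeRF12 w e₁ s(s, z) (openConn s b) (openConn s c) (openConn s y) ∧
        0 ≤ twoEdgeRF21 w e₁ s(s, z) (openConn s b) (openConn s c) (openConn s y) ∧
        0 ≤ twoEdgeRF22 w e₁ s(s, z) (openConn s b) (openConn s c) (openConn s y)) :
    ∀ (w : Sym2 (Fin n) → unitInterval) (s z b c y : Fin n), z ≠ s →
      0 ≤ polar₁ (prodBernoulli (Function.update w s(s, z) 0)) (prodBernoulli (Function.update w s(s, z) 1))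
          (openConn s b) (openConn s c) (openConn s y) ∧
        0 ≤ polar₁ (prodBernoulli (Function.update w s(s, z) 1)) (prodBernoulli (Function.update w s(s, z) 0))
          (openConn s b) (openConn s c) (openConn s y) := by
  suffices H : ∀ (k : ℕ) (w : Sym2 (Fin n) → unitInterval) (s z b c y : Fin n), z ≠ s →
      ((fracEdges w).filter fun f => ¬ f.IsDiag ∧ f ≠ s(s, z)).card ≤ k →
      0 ≤ polar₁ (prodBernoulli (Function.update w s(s, z) 0)) (prodBernoulli (Function.update w s(s, z) 1))
          (openConn s b) (openConn s c) (openConn s y) ∧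
        0 ≤ polar₁ (prodBernoulli (Function.update w s(s, z) 1)) (prodBernoulli (Function.update w s(s, z) 0))
          (openConn s b) (openConn s c) (openConn s y) from
    fun w s z b c y hzs => H _ w s z b c y hzs le_rfl
  intro k
  induction k with
  | zero =>
      intro w s z b c y hzs hk
      refine rootEdgeBernstein_of_detOffPair w s z b c y ?_
      intro f hf hfe
      apply eq_zero_or_one_of_not_mem_fracEdges
      intro hmem
      have : f ∈ (fracEdges w).filter fun f => ¬ f.IsDiag ∧ f ≠ s(s, z) := Finset.mem_filter.2 ⟨hmem, hf, hfe⟩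
      have := Finset.card_pos.2 ⟨_, this⟩
      omega
  | succ k ih =>
      intro w s z b c y hzs hk
      by_cases hfr : ∃ e₁ : Sym2 (Fin n), e₁ ∈ fracEdges w ∧ ¬ e₁.IsDiag ∧ e₁ ≠ s(s, z)
      · obtain ⟨e₁, he₁, hnd, hne⟩ := hfr
        have hcard : ∀ (u : unitInterval), u = 0 ∨ u = 1 →
            ((fracEdges (Function.update w e₁ u)).filter fun f => ¬ f.IsDiag ∧ f ≠ s(s, z)).card ≤ k := by
          intro u hu
          have := card_fracOff_update_lt w he₁ hnd hne u hu
          omega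
        obtain ⟨i01, i02⟩ := ih (Function.update w e₁ 0) s z b c y hzs (hcard 0 (Or.inl rfl))
        obtain ⟨i31, i32⟩ := ih (Function.update w e₁ 1) s z b c y hzs (hcard 1 (Or.inr rfl))
        obtain ⟨f11, f12, f21, f22⟩ := hT w s z b c y e₁ hzs hne hnd he₁
        exact rootEdgeBernstein_of_twoEdgeFibres w hne (openConn s b) (openConn s c) (openConn s y)
          i01 i02 i31 i32 f11 f12 f21 f22
      · push Not at hfr
        refine rootEdgeBernstein_of_detOffPair w s z b c y ?_
        intro f hf hfe
        apply eq_zero_or_one_of_not_mem_fracEdges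
        intro hmem
        exact hfe (hfr f hmem hf)

/-- **THE INCREASING STAR ON EVERY FINITE WEIGHTED GRAPH FROM THE FOUR MIXED TWO-EDGE FIBRES (𝒯₂).**  Under the hypothesis of
`rootEdgeBernstein_of_twoEdgeFibres_all`, `E₃({s↔b},{s↔c},{s↔y}) ≥ 0` under `prodBernoulli w` for every weight `w` on the pairs of `Fin n` and all
`s b c y` — gen 5's root-edge schema `incStar_nonneg_of_rootEdgeBernsteinStrongIH` fed with hRZ from the previous theorem. [this work] -/
theorem incStar_nonneg_of_twoEdgeFibres
    (hT : ∀ (w : Sym2 (Fin n) → unitInterval) (s z b c y : Fin n) (e₁ : Sym2 (Fin n)),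
      z ≠ s → e₁ ≠ s(s, z) → ¬ e₁.IsDiag → e₁ ∈ fracEdges w →
      0 ≤ twoEdgeRF11 w e₁ s(s, z) (openConn s b) (openConn s c) (openConn s y) ∧
        0 ≤ twoEdgeRF12 w e₁ s(s, z) (openConn s b) (openConn s c) (openConn s y) ∧
        0 ≤ twoEdgeRF21 w e₁ s(s, z) (openConn s b) (openConn s c) (openConn s y) ∧
        0 ≤ twoEdgeRF22 w e₁ s(s, z) (openConn s b) (openConn s c) (openConn s y)) :
    ∀ (w : Sym2 (Fin n) → unitInterval) (s b c y : Fin n),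
      0 ≤ sahiE3 (prodBernoulli w) (openConn s b) (openConn s c) (openConn s y) := by
  refine incStar_nonneg_of_rootEdgeBernsteinStrongIH ?_
  intro w s b c y v hvs _ _
  exact rootEdgeBernstein_of_twoEdgeFibres_all hT w s v b c y hvs

end IncStar

end Summit.CriticalPhenomena.PercolationContinuityZ3.Theorems

end
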